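import Summits.Ventures.PercRepro.RankLevelSetHallCoopShareArith

/-!
# PercRepro — THE ARITHMETIC OF THE COLOOP-SHARE KERNEL FOR EVERY `k` (p4, gen 38; paper proofs/P4-KERNEL-A-DEAD.md §4 (ii))

The receipt identity of RankLevelSetHallCoopShareArith (`key_eq`: `(q + 2 − d)·Σ (j+1) P_j = (q+1) + Σ P_j + (q − d) Σ j P_j`)
gives, for every `k ≥ 2`, `(q + k − d)·Σ_{j ≤ d} (j+1) P_j ≥ q + k` (`key_ge_k`: add `(k − 2)·Σ (j+1) P_j ≥ k − 2`), hence
`(q + k)/(q + 1) ≤ (q + k − d)·Σ_{j ≤ d} C(d, j)/C(q + j + 1, j + 1)` for `d ≤ q` (`receipt_bound_k`) — the receipt bound of the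
coloop-share kernel on the rank-`(q+1)` sets of the tight layer `#E = 2q + k`, where a member with `d` lost elements has
`ω = q + k − d` outside elements.  `k = 2` recovers `receipt_bound`.

* `sum_succ_mul_P_ge_one` — `Σ_{j ≤ d} (j + 1) P_j ≥ 1`;
* **`key_ge_k`**, **`receipt_bound_k`**.
Axioms: standard.
-/

namespace PercRepro.CoopShare

open Finset

/-- `Σ_{j ≤ d} (j + 1) P_j ≥ 1` (the `j = 0` term is `1`, the others are non-negative). -/
theorem sum_succ_mul_P_ge_one (q d : ℕ) : 1 ≤ ∑ j ∈ range (d + 1), ((j : ℚ) + 1) * P q d j := by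
  have h0 : ((0 : ℕ) : ℚ) + 1 ≤ 1 := by norm_num
  have hterm : ((0 : ℕ) : ℚ) + 1 ≤ ∑ j ∈ range (d + 1), ((j : ℚ) + 1) * P q d j := by
    have := Finset.single_le_sum (f := fun j : ℕ => ((j : ℚ) + 1) * P q d j) (s := range (d + 1))
      (fun j hj => by
        rw [Finset.mem_range] at hj
        exact mul_nonneg (by positivity) (P_nonneg q d (by omega)))
      (by rw [Finset.mem_range]; omega : 0 ∈ range (d + 1))
    simp only [P_zero, mul_one] at this
    exact this
  linarith

/-- **The receipt bound for every `k ≥ 2`**: for `d ≤ q`, `(q + k − d) · Σ_{j ≤ d} (j + 1) P_j ≥ q + k`. -/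
theorem key_ge_k (q d k : ℕ) (hd : d ≤ q) (hk : 2 ≤ k) :
    (q : ℚ) + k ≤ ((q : ℚ) + k - d) * (∑ j ∈ range (d + 1), ((j : ℚ) + 1) * P q d j) := by
  have h2 := key_ge q d hd
  have hW := sum_succ_mul_P_ge_one q d
  have hk' : (2 : ℚ) ≤ k := by exact_mod_cast hk
  have hsplit : ((q : ℚ) + k - d) * (∑ j ∈ range (d + 1), ((j : ℚ) + 1) * P q d j)
      = ((q : ℚ) + 2 - d) * (∑ j ∈ range (d + 1), ((j : ℚ) + 1) * P q d j)
        + ((k : ℚ) - 2) * (∑ j ∈ range (d + 1), ((j : ℚ) + 1) * P q d j) := by ring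
  rw [hsplit]
  nlinarith [mul_le_mul_of_nonneg_left hW (by linarith : (0 : ℚ) ≤ (k : ℚ) - 2)]

/-- **The receipt bound in binomial form, every `k ≥ 2`**: for `d ≤ q`,
`(q + k)/(q + 1) ≤ (q + k − d) · Σ_{j ≤ d} C(d, j) / C(q + j + 1, j + 1)`. -/
theorem receipt_bound_k (q d k : ℕ) (hd : d ≤ q) (hk : 2 ≤ k) :
    ((q : ℚ) + k) / ((q : ℚ) + 1)
      ≤ ((q : ℚ) + k - d) * ∑ j ∈ range (d + 1), (d.choose j : ℚ) / ((q + j + 1).choose (j + 1) : ℚ) := by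
  have hq : ((q : ℚ) + 1) ≠ 0 := by positivity
  have hconv : ∀ j ∈ range (d + 1), (d.choose j : ℚ) / ((q + j + 1).choose (j + 1) : ℚ)
      = (((j : ℚ) + 1) * P q d j) / ((q : ℚ) + 1) := by
    intro j _
    have hc : ((q + j + 1).choose (j + 1) : ℚ) ≠ 0 := by
      have : 0 < (q + j + 1).choose (j + 1) := Nat.choose_pos (by omega)
      exact_mod_cast this.ne'
    have h := choose_eq_P q d j
    field_simp
    linear_combination h
  rw [Finset.sum_congr rfl hconv, ← Finset.sum_div]
  have hk' := key_ge_k q d k hd hk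
  rw [div_le_iff₀ (by positivity : (0 : ℚ) < (q : ℚ) + 1)]
  calc (q : ℚ) + k ≤ ((q : ℚ) + k - d) * (∑ j ∈ range (d + 1), ((j : ℚ) + 1) * P q d j) := hk'
    _ = ((q : ℚ) + k - d) * ((∑ j ∈ range (d + 1), ((j : ℚ) + 1) * P q d j) / ((q : ℚ) + 1)) * ((q : ℚ) + 1) := by
        field_simp

end PercRepro.CoopShare
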